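import Summits.AtomisticToContinuum.HydrodynamicLimit.Theses.LindebergRandomFuture
import Summits.AtomisticToContinuum.HydrodynamicLimit.Theorems.LambertianContactSwapLambertianEulerOfHearts
import Summits.AtomisticToContinuum.HydrodynamicLimit.Theses.LambertianContactSwap
import Summits.AtomisticToContinuum.HydrodynamicLimit.Theorems.LambertianContactSwapLambertianEulerArchimedes
import Summits.AtomisticToContinuum.HydrodynamicLimit.Theorems.LambertianContactSwapLambertianEulerLambertLaw
import Summits.AtomisticToContinuum.HydrodynamicLimit.Theorems.LambertianContactSwapLambertianEulerPovzner
import Summits.AtomisticToContinuum.HydrodynamicLimit.Theorems.LambertianContactSwapLambertianEulerPairPovzner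
import Summits.AtomisticToContinuum.HydrodynamicLimit.Theorems.LambertianContactSwapLambertianEulerContactIsotropy
import Summits.AtomisticToContinuum.HydrodynamicLimit.Theorems.LambertianContactSwapLambertianEulerMomentLedgerChain
import Summits.AtomisticToContinuum.HydrodynamicLimit.Theorems.LambertianContactSwapLambertianEulerGibbsInvariance
import Summits.AtomisticToContinuum.HydrodynamicLimit.Theorems.LambertianContactSwapLambertianEulerEntropyToHydro
import Summits.AtomisticToContinuum.HydrodynamicLimit.Theorems.LambertianContactSwapLambertianEulerWindow
import Summits.AtomisticToContinuum.HydrodynamicLimit.Theorems.LambertianContactSwapLambertianEulerMarkov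
import Summits.AtomisticToContinuum.HydrodynamicLimit.Theorems.LambertianContactSwapLambertianEulerIterate
import Summits.AtomisticToContinuum.HydrodynamicLimit.Theorems.LambertianContactSwapLambertianEulerDock
import Summits.AtomisticToContinuum.HydrodynamicLimit.Theorems.LambertianContactSwapLambertianEulerKlLedger
import Summits.AtomisticToContinuum.HydrodynamicLimit.Theorems.LambertianContactSwapLambertianEulerLawSemigroup
import Summits.AtomisticToContinuum.HydrodynamicLimit.Theorems.LambertianContactSwapLambertianEulerDockRf
import Summits.AtomisticToContinuum.HydrodynamicLimit.Theorems.LambertianContactSwapLambertianEulerLambertDirMean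
import Summits.AtomisticToContinuum.HydrodynamicLimit.Theorems.LambertianContactSwapLambertianEulerPairMeanSq
import Summits.AtomisticToContinuum.HydrodynamicLimit.Theorems.LambertianContactSwapLambertianEulerPathwiseProduction
import Summits.AtomisticToContinuum.HydrodynamicLimit.Theorems.LambertianContactSwapLambertianEulerWindowLedger
import Summits.AtomisticToContinuum.HydrodynamicLimit.Theorems.LambertianContactSwapLambertianEulerCollisionCompensator
import Summits.AtomisticToContinuum.HydrodynamicLimit.Theorems.LambertianContactSwapLambertianEulerCompensatedJump
import Summits.AtomisticToContinuum.HydrodynamicLimit.Theorems.LambertianContactSwapLambertianEulerAprioriEntropyBound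
import Summits.AtomisticToContinuum.HydrodynamicLimit.Theorems.LambertianContactSwapLambertianEulerCollisionIntensity
import Summits.AtomisticToContinuum.HydrodynamicLimit.Theorems.LambertianContactSwapLambertianEulerTwoTimeLaw
import Summits.AtomisticToContinuum.HydrodynamicLimit.Theorems.LambertianContactSwapLambertianEulerCollisionBudget
import Summits.AtomisticToContinuum.HydrodynamicLimit.Theorems.LambertianContactSwapLambertianEulerExpectedWindowProductionTools
import Summits.AtomisticToContinuum.HydrodynamicLimit.Theorems.LambertianContactSwapLambertianEulerExpectedWindowProduction
import Summits.AtomisticToContinuum.HydrodynamicLimit.Theorems.LambertianContactSwapLambertianEulerProductionSplit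
import Summits.AtomisticToContinuum.HydrodynamicLimit.Theorems.TwoClocksClampedEntropyClockTimeZeroReference
import Summits.AtomisticToContinuum.HydrodynamicLimit.Theorems.TwoClocksClampedEntropyClockDiscreteEntropyGronwall
import Summits.AtomisticToContinuum.HydrodynamicLimit.Theorems.TwoClocksClampedEntropyClockKlDivLawAtLocalGibbsNeTop
import Literature.MathematicalPhysics.KineticTheory.LambertianRedrawNondegenerate
import Literature.MathematicalPhysics.KineticTheory.Hilbert6Wave0Proofs
import Literature.MathematicalPhysics.KineticTheory.HardSphereEulerLLN
import Literature.Barriers.AtomisticToContinuum.HighMomentumCutoff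
import Literature.Analysis.FluidPDE.HardSphereAlexander
import HarnessLib

/-! TTRL-lite variant V12905 of stmt-AtomisticToContinuum-11854 -/

namespace Summit.AtomisticToContinuum.HydrodynamicLimit.Theorems

open scoped BigOperators Topology ENNReal InnerProductSpace
open MeasureTheory ProbabilityTheory Filter Set InformationTheory
open Literature.MathematicalPhysics.KineticTheory
open Literature.Analysis.FluidPDE Literature.Analysis.FluidPDE.Alexander
open Summit.AtomisticToContinuum.HydrodynamicLimit.Theses.LambertianContactSwap
open Summit.AtomisticToContinuum.HydrodynamicLimit.Theorems.ClampedCurrentsDockPathwise (gSum DgSum)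

/-- TTRL-lite variant V12905 of `stmt-AtomisticToContinuum-11854` (chopping step 2 of the
clamped window-LD input): an interval of length `D ≥ h₀ > 0` splits into `m := ⌊D/h₀⌋₊ ≥ 1`
equal windows of length `D/m ∈ [h₀, 2h₀]`. -/
theorem atom11854_kineticoneblockinme_var12905 :
    ∀ (D h₀ : ℝ), 0 < h₀ → h₀ ≤ D →
      ∃ m : ℕ, 1 ≤ m ∧ h₀ ≤ D / (m : ℝ) ∧ D / (m : ℝ) ≤ 2 * h₀ := by
  intro D h₀ hh hD
  have hq : (1 : ℝ) ≤ D / h₀ := by rw [le_div_iff₀ hh, one_mul]; exact hD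
  obtain ⟨m, hm⟩ : ∃ m : ℕ, m = ⌊D / h₀⌋₊ := ⟨_, rfl⟩
  have hm1 : 1 ≤ m := by
    rw [hm]; exact Nat.le_floor (by exact_mod_cast hq)
  have hmR : (1 : ℝ) ≤ m := by exact_mod_cast hm1
  have hmpos : (0 : ℝ) < m := by linarith
  have hfl : (m : ℝ) ≤ D / h₀ := by rw [hm]; exact Nat.floor_le (by linarith)
  have hlt : D / h₀ < m + 1 := by rw [hm]; exact Nat.lt_floor_add_one _
  have h1 : (m : ℝ) * h₀ ≤ D := by rwa [le_div_iff₀ hh] at hfl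
  have h2 : D < ((m : ℝ) + 1) * h₀ := by rwa [div_lt_iff₀ hh] at hlt
  have h3 : (1 : ℝ) * h₀ ≤ (m : ℝ) * h₀ := mul_le_mul_of_nonneg_right hmR hh.le
  refine ⟨m, hm1, ?_, ?_⟩
  · rw [le_div_iff₀ hmpos]; linarith
  · rw [div_le_iff₀ hmpos]; nlinarith

end Summit.AtomisticToContinuum.HydrodynamicLimit.Theorems
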